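import Literature.Probability.Percolation.PercolationProofs
import Literature.Probability.Percolation.SharpnessDCTProofs
import HarnessLib

/-!
# Crux `PercNearOneGluing.AdditiveGluing` (stmt-CriticalPhenomena-4576), line `replica-splice-at-entrance` —
# stub `stub_lastExitCut` (the last-exit decomposition at the entrance stopping set)

Helper file for the crux skeleton of the line `replica-splice-at-entrance` (lead
prover-line-stmt-CriticalPhenomena-4576-c2-0): proves exactly the registered stub signature
`stub_lastExitCut` (pure combinatorics of open paths, no measure theory); lands with
`--supports stmt-CriticalPhenomena-4576`.

## Content

Fix a relay set `A ⊆ Fin n` with `b ∈ A`, a source `o` and a bond configuration `ω`.  The `A`-AVOIDING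
POCKET of `o` is `W(ω) = {v | o ↔ v by an open path inside Aᶜ}` (`= ∅` when `o ∈ A`) and the ENTRANCE SET
(first contacts) is `N(ω) = {a ∈ A | o ↔ a by an open path inside Aᶜ ∪ {a}}`.  On the event
`{W(ω) = W, N(ω) = N}` one has `o ↔ b` iff some `a ∈ N` is joined to `b` by an open path avoiding `W`
(Kozma–Nitzan, arXiv:2401.12397, proof of Thm 5; Grimmett 1999 §1.3: cut an open path at its LAST EXIT from
the pocket).

## Proof

Pointwise in `ω` (so `W = W(ω)`, `N = N(ω)`; unrealised data give `∅ = ∅` automatically).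
* (⇐) `a ∈ N(ω)` gives `o ↔ a`, and `a ↔ b in Wᶜ` gives `a ↔ b`.
* (⇒) If `o ∈ A` then `W(ω) = ∅`, `o ∈ N(ω)` and an open path from `o` to `b` is a path inside
  `∅ᶜ`.  If `o ∉ A` then `o ∈ W(ω) ∌ b`; the last exit (`PathIn.last_exit`) of an open path from `o` to
  `b` out of `W(ω)` is an open pair `{x, y}` with `x ∈ W(ω)`, `y ∉ W(ω)` followed by an open path from `y`
  to `b` avoiding `W(ω)`; `y ∈ A` (otherwise the `Aᶜ`-path to `x` extended by `{x, y}` would put `y` in the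
  pocket), hence `y ∈ N(ω)` (that extended path lies inside `Aᶜ ∪ {y}`).
-/

namespace Summit.CriticalPhenomena.PercolationContinuityZ3.Theorems

open MeasureTheory Literature.Probability.LatticeModels Literature.Probability.Percolation
open scoped Classical BigOperators

open Literature.Probability.Percolation.DCT16 (pathIn_of_mem_openConnIn mem_openConnIn_of_pathIn
  reachable_of_pathIn pathIn_univ_of_reachable)

/-- **Last-exit decomposition, pointwise.** For `b ∈ A` and a configuration `ω`: `o ↔ b` iff some first
contact `a` (i.e. `a ∈ A` with `o ↔ a` inside `Aᶜ ∪ {a}`) is joined to `b` by an open path avoiding the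
`A`-avoiding pocket `{v | o ↔ v inside Aᶜ}` of `o`. [folklore; Kozma–Nitzan arXiv:2401.12397 proof of Thm 5] -/
theorem lastExitCut_pointwise {n : ℕ} (A : Finset (Fin n)) (o b : Fin n) (hb : b ∈ A)
    (ω : BondConfig (Fin n)) :
    ω ∈ openConn o b ↔
      ∃ a ∈ A, ω ∈ openConnIn (insert a ((↑A : Set (Fin n))ᶜ)) o a ∧
        ω ∈ openConnIn {v | ω ∈ openConnIn ((↑A : Set (Fin n))ᶜ) o v}ᶜ a b := by
  constructor
  · intro hob
    have hpath : PathIn (openGraph ω) Set.univ o b := pathIn_univ_of_reachable hob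
    by_cases ho : o ∈ A
    · -- the pocket is empty and `o` is its own first contact
      refine ⟨o, ho, mem_openConnIn_of_pathIn (PathIn.refl (Set.mem_insert _ _)),
        mem_openConnIn_of_pathIn (hpath.mono fun v _ hv => ?_)⟩
      obtain ⟨hoA, -⟩ := hv
      exact hoA ho
    · -- cut the path at its last exit from the pocket
      have hoW : o ∈ {v | ω ∈ openConnIn ((↑A : Set (Fin n))ᶜ) o v} :=
        mem_openConnIn_of_pathIn (PathIn.refl (show o ∈ ((↑A : Set (Fin n))ᶜ) from
          fun h => ho (Finset.mem_coe.1 h)))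
      have hbW : b ∉ {v | ω ∈ openConnIn ((↑A : Set (Fin n))ᶜ) o v} := by
        intro h
        obtain ⟨-, hbA, -⟩ := h
        exact hbA (Finset.mem_coe.2 hb)
      obtain ⟨x, y, hx, -, hy, hxy, hyb⟩ := hpath.last_exit hoW hbW
      have hox : PathIn (openGraph ω) ((↑A : Set (Fin n))ᶜ) o x := pathIn_of_mem_openConnIn hx
      have hyA : y ∈ A := by
        by_contra hyA
        exact hy (mem_openConnIn_of_pathIn (hox.tail hxy fun h => hyA (Finset.mem_coe.1 h)))
      refine ⟨y, hyA, mem_openConnIn_of_pathIn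
        ((hox.mono (Set.subset_insert _ _)).tail hxy (Set.mem_insert _ _)),
        mem_openConnIn_of_pathIn (hyb.mono fun v hv => hv.2)⟩
  · rintro ⟨a, -, hoa, hab⟩
    exact (reachable_of_pathIn (pathIn_of_mem_openConnIn hoa)).trans
      (reachable_of_pathIn (pathIn_of_mem_openConnIn hab))

/-- Registered stub `stub_lastExitCut` of crux stmt-CriticalPhenomena-4576 (line replica-splice-at-entrance):
**last-exit decomposition at the entrance stopping set.** With `W(ω) := {v | o ↔ v inside Aᶜ}` (the
`A`-avoiding pocket) and `N(ω) := {a ∈ A | o ↔ a inside Aᶜ ∪ {a}}` (first contacts): on the event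
`{W(ω) = W, N(ω) = N}`, for `b ∈ A`, `o ↔ b` holds iff some `a ∈ N` is joined to `b` by an open path avoiding
`W`. [folklore; Kozma–Nitzan arXiv:2401.12397 proof of Thm 5, Grimmett 1999 §1.3] -/
theorem stub_lastExitCut :
    ∀ (n : ℕ) (A : Finset (Fin n)) (o b : Fin n), b ∈ A → ∀ (W N : Finset (Fin n)),
      {ω : BondConfig (Fin n) |
          (Finset.univ.filter fun v => ω ∈ openConnIn ((↑A : Set (Fin n))ᶜ) o v) = W ∧
          (A.filter fun a => ω ∈ openConnIn (insert a ((↑A : Set (Fin n))ᶜ)) o a) = N} ∩ openConn o b =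
      {ω : BondConfig (Fin n) |
          (Finset.univ.filter fun v => ω ∈ openConnIn ((↑A : Set (Fin n))ᶜ) o v) = W ∧
          (A.filter fun a => ω ∈ openConnIn (insert a ((↑A : Set (Fin n))ᶜ)) o a) = N} ∩
        ⋃ a ∈ N, openConnIn ((↑W : Set (Fin n))ᶜ) a b := by
  intro n A o b hb W N
  ext ω
  simp only [Set.mem_inter_iff, Set.mem_setOf_eq, Set.mem_iUnion, exists_prop]
  refine ⟨fun h => ⟨h.1, ?_⟩, fun h => ⟨h.1, ?_⟩⟩
  · obtain ⟨⟨hW, hN⟩, hob⟩ := h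
    obtain ⟨a, haA, hoa, hab⟩ := (lastExitCut_pointwise A o b hb ω).1 hob
    have hWset : ((↑W : Set (Fin n))ᶜ) = {v | ω ∈ openConnIn ((↑A : Set (Fin n))ᶜ) o v}ᶜ := by
      rw [← hW, Finset.coe_filter]
      simp
    refine ⟨a, ?_, ?_⟩
    · rw [← hN]
      exact Finset.mem_filter.2 ⟨haA, hoa⟩
    · rw [hWset]
      exact hab
  · obtain ⟨⟨hW, hN⟩, a, haN, hab⟩ := h
    rw [← hN] at haN
    obtain ⟨haA, hoa⟩ := Finset.mem_filter.1 haN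
    exact (reachable_of_pathIn (pathIn_of_mem_openConnIn hoa)).trans
      (reachable_of_pathIn (pathIn_of_mem_openConnIn hab))

end Summit.CriticalPhenomena.PercolationContinuityZ3.Theorems
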